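import Summits.AtomisticToContinuum.Crystallization.Theorems.FrustratedLawDichotomyStrainedPatchChartFamilies

/-!
# Chart families, sequel: g50's instance, the root law and exterior column, BENT (two-scale) families, the record («ChartFamiliesBent», lens-5 g51 §§3–5)

SPLIT (lens-5 g52, critic ROW 900: 400-line limit) of «ChartFamilies» (g51): this file holds §§3–5 with the declaration text unchanged; the module docstring of
`…StrainedPatchChartFamilies` describes the whole.  §3: g50's (E1-At) / (E2) / (E3) ARE the instance (`homFamily η₃`, `lsqModulus ℓ s q`, `linearLaw κ κ₁`) of
the parametric engine (F1) / (F2) / (F3) — proved as equivalences — and the ROOT law `κ·room + κ½·√room + κ₁σ₁` and a `t`-independent EXTERIOR-TEXTURE column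
(`lsqxModulus`) are further instances.  §4: `IsBentBall 𝓑 R`, `bentFamily 𝓑 η₃ ⊇ homFamily η₃` (`id ∈ 𝓑`), hence the trades hom-room ⟹ bent-room, bent-envelope /
bent-certificate ⟹ hom ones, and the bent / mixed lines decide the edge band.  §5: the record (`ρ = 24/5`, `ε = 1/100`, any `φ₁ ≥ 0`) threaded to
`CoreOffTubeFloor (63/10) (63/10) (24/5) (1/100) φ₁` and `StrainedPatchRec` with the [SOFT-FAR] residual of record.  Lean fixes no census number; no new axioms,
no cite tokens, no instances / notation.
-/

namespace Summit.AtomisticToContinuum.Crystallization.Theorems.FrustratedLawDichotomyStrainedPatchChartFamiliesBent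
open Summit.AtomisticToContinuum.Crystallization.Theorems.FrustratedLawDichotomyPeriodicBlockFlags (goodAtScale_mono)

open scoped BigOperators Classical
open Summit.AtomisticToContinuum.Crystallization.Theorems.FrustratedLawDichotomyMotifLemmas
open Summit.AtomisticToContinuum.Crystallization.Theorems.FrustratedLawDichotomyAveragingCut
open Summit.AtomisticToContinuum.Crystallization.Theorems.FrustratedLawDichotomyAveragingRuleCap
open Summit.AtomisticToContinuum.Crystallization.Theorems.FrustratedLawDichotomyAveragingRuleTightFree
open Summit.AtomisticToContinuum.Crystallization.Theorems.FrustratedLawDichotomyExemptDoor (SitePred)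
open Summit.AtomisticToContinuum.Crystallization.Theorems.FrustratedLawDichotomyExemptAbsorption
open Summit.AtomisticToContinuum.Crystallization.Theorems.FrustratedLawDichotomyExemptAbsorptionRecord
open Summit.AtomisticToContinuum.Crystallization.Theorems.FrustratedLawDichotomyCollarCensus
open Summit.AtomisticToContinuum.Crystallization.Theorems.FrustratedLawDichotomyCollarCensusKappa
open Summit.AtomisticToContinuum.Crystallization.Theorems.FrustratedLawDichotomyStrainedPatchHomSplit
open Summit.AtomisticToContinuum.Crystallization.Theorems.FrustratedLawDichotomyStrainedPatchCleanCollar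
open Summit.AtomisticToContinuum.Crystallization.Theorems.FrustratedLawDichotomyStrainedPatchHomTube
open Summit.AtomisticToContinuum.Crystallization.Theorems.FrustratedLawDichotomyStrainedPatchHomIsometry
open Summit.AtomisticToContinuum.Crystallization.Theorems.FrustratedLawDichotomyStrainedPatchHomTubeIso
open Summit.AtomisticToContinuum.Crystallization.Theorems.FrustratedLawDichotomyStrainedPatchPhaseCut
open Summit.AtomisticToContinuum.Crystallization.Theorems.FrustratedLawDichotomyStrainedPatchCoreTube
open Summit.AtomisticToContinuum.Crystallization.Theorems.FrustratedLawDichotomyStrainedPatchCoreTubeRecord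
open Summit.AtomisticToContinuum.Crystallization.Theorems.FrustratedLawDichotomyStrainedPatchCoreTubeMilli
open Summit.AtomisticToContinuum.Crystallization.Theorems.FrustratedLawDichotomyStrainedPatchStrainBands
open Summit.AtomisticToContinuum.Crystallization.Theorems.FrustratedLawDichotomyStrainedPatchChartFamilies

/-! ## §3. Instances: g50's line is (`homFamily η₃`, `lsqModulus ℓ s q`, `linearLaw κ κ₁`); the root law; the exterior column -/

/-- The HOMOGENEOUS chart family of g50 on the stable range: admissible homogeneous instances with an `η₃`-good centre. -/
def homFamily (η₃ : ℝ) : (M₀ : ℕ) → (Fin M₀ → E3) → Fin M₀ → Prop :=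
  fun M₀ z₀ c₀ => Admissible M₀ z₀ c₀ ∧ IsHomBall (133 / 10) z₀ c₀ ∧ GoodAtScale η₃ (3 / 2) z₀ c₀

/-- g50's three-column modulus: `ℓ(z₀)·t + s(z₀)·σ₁ + q(z₀)·t²` (roughness, force slack, curvature). -/
noncomputable def lsqModulus (ℓ s q : (M₀ : ℕ) → (Fin M₀ → E3) → Fin M₀ → ℝ) : (M₀ : ℕ) → (Fin M₀ → E3) → Fin M₀ → ℝ → ℝ :=
  fun M₀ z₀ c₀ t => ℓ M₀ z₀ c₀ * t + s M₀ z₀ c₀ * sigmaOne + q M₀ z₀ c₀ * t ^ 2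

/-- g50's LINEAR room law `κ·windowRoom(z₀) + κ₁·σ₁` (the flagged one). -/
noncomputable def linearLaw (κ κ₁ : ℝ) : (M₀ : ℕ) → (Fin M₀ → E3) → Fin M₀ → ℝ :=
  fun _ z₀ c₀ => κ * windowRoom z₀ c₀ + κ₁ * sigmaOne

/-- The ROOT room law `κ·room + κ½·√room + κ₁·σ₁` (the law if the window cone binds only at second order along neutral directions). -/
noncomputable def rootLaw (κ κh κ₁ : ℝ) : (M₀ : ℕ) → (Fin M₀ → E3) → Fin M₀ → ℝ :=
  fun _ z₀ c₀ => κ * windowRoom z₀ c₀ + κh * Real.sqrt (windowRoom z₀ c₀) + κ₁ * sigmaOne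

/-- The four-column modulus with a `t`-independent EXTERIOR-TEXTURE column `x(z₀)` (memo FLAG-3): `ℓ·t + s·σ₁ + q·t² + x`. -/
noncomputable def lsqxModulus (ℓ s q x : (M₀ : ℕ) → (Fin M₀ → E3) → Fin M₀ → ℝ) : (M₀ : ℕ) → (Fin M₀ → E3) → Fin M₀ → ℝ → ℝ :=
  fun M₀ z₀ c₀ t => ℓ M₀ z₀ c₀ * t + s M₀ z₀ c₀ * sigmaOne + q M₀ z₀ c₀ * t ^ 2 + x M₀ z₀ c₀

/-- The homogeneous family grows with `η₃`. [formal bookkeeping] -/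
theorem homFamily_le {η₃ η₃' : ℝ} (hle : η₃ ≤ η₃') : FamilyLE (homFamily η₃) (homFamily η₃') :=
  fun _ _ _ h => ⟨h.1, h.2.1, goodAtScale_mono hle h.2.2⟩

/-- A g50 chart by an `η₃`-good instance IS a chart by the homogeneous family. [formal bookkeeping] -/
theorem chartBy_hom_iff {η₃ τ t : ℝ} {M : ℕ} (z : Fin M → E3) (c : Fin M) {M₀ : ℕ} (z₀ : Fin M₀ → E3) (c₀ : Fin M₀) (e : Fin M → Fin M₀) :
    ChartBy (homFamily η₃) τ t z c z₀ c₀ e ↔ GoodAtScale η₃ (3 / 2) z₀ c₀ ∧ EnvChart τ t z c z₀ c₀ e := by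
  constructor
  · rintro ⟨⟨hz₀, hhom, hg⟩, hrest⟩
    exact ⟨hg, hz₀, hhom, hrest⟩
  · rintro ⟨hg, hz₀, hhom, hrest⟩
    exact ⟨⟨hz₀, hhom, hg⟩, hrest⟩

/-- ★ (E1-At) IS (F1) at (`homFamily η₃`, `lsqModulus ℓ s q`). [formal bookkeeping] -/
theorem familyEnvelope_hom_iff (η₃ τ : ℝ) (ℓ s q : (M₀ : ℕ) → (Fin M₀ → E3) → Fin M₀ → ℝ) :
    FamilyEnvelope (homFamily η₃) τ (lsqModulus ℓ s q) ↔ SlavedEnvelopeAt η₃ τ ℓ s q := by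
  constructor
  · intro h M z c M₀ z₀ c₀ e t hz hcl hm ht hg hch
    have h₁ := h M z c M₀ z₀ c₀ e t hz hcl hm ht ((chartBy_hom_iff z c z₀ c₀ e).2 ⟨hg, hch⟩)
    simp only [lsqModulus] at h₁
    linarith
  · intro h M z c M₀ z₀ c₀ e t hz hcl hm ht hch
    obtain ⟨hg, hch'⟩ := (chartBy_hom_iff z c z₀ c₀ e).1 hch
    have h₁ := h M z c M₀ z₀ c₀ e t hz hcl hm ht hg hch'
    simp only [lsqModulus]
    linarith

/-- ★ (E2) IS (F2) at (`homFamily η₃`, `linearLaw κ κ₁`). [formal bookkeeping] -/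
theorem familyRoom_hom_iff (ρ ε η₂ η₃ τ κ κ₁ : ℝ) :
    FamilyRoom (homFamily η₃) ρ ε η₂ τ (linearLaw κ κ₁) ↔ ChartRoom ρ ε η₂ η₃ τ κ κ₁ := by
  constructor
  · intro h M z c hz hcl hm hn hg
    obtain ⟨R, M₀, z₀, c₀, e, ht, hch⟩ := h M z c hz hcl hm hn hg
    obtain ⟨hg₃, hch'⟩ := (chartBy_hom_iff (⇑R ∘ z) c z₀ c₀ e).1 hch
    exact ⟨R, M₀, z₀, c₀, e, hg₃, ht, hch'⟩
  · intro h M z c hz hcl hm hn hg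
    obtain ⟨R, M₀, z₀, c₀, e, hg₃, ht, hch⟩ := h M z c hz hcl hm hn hg
    exact ⟨R, M₀, z₀, c₀, e, ht, (chartBy_hom_iff (⇑R ∘ z) c z₀ c₀ e).2 ⟨hg₃, hch⟩⟩

/-- ★ (E3) IS (F3) at (`homFamily η₃`, `lsqModulus ℓ s q`, `linearLaw κ κ₁`). [formal bookkeeping] -/
theorem familyCert_hom_iff (η₃ κ κ₁ φ : ℝ) (ℓ s q : (M₀ : ℕ) → (Fin M₀ → E3) → Fin M₀ → ℝ) :
    FamilyCert (homFamily η₃) φ (lsqModulus ℓ s q) (linearLaw κ κ₁) ↔ EnvelopeCert η₃ κ κ₁ φ ℓ s q := by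
  constructor
  · intro h M₀ z₀ c₀ hz₀ hhom hg
    have h₁ := h M₀ z₀ c₀ ⟨hz₀, hhom, hg⟩
    simp only [lsqModulus, linearLaw] at h₁
    linarith
  · intro h M₀ z₀ c₀ hI
    have h₁ := h M₀ z₀ c₀ hI.1 hI.2.1 hI.2.2
    simp only [lsqModulus, linearLaw]
    linarith

/-- Hence the §1 seam is the parametric seam at g50's instance (second proof, through §2). [formal bookkeeping] -/
theorem edgeFar_of_envelopeAt_of_room_of_cert' {ρ ε η₂ η₃ τ κ κ₁ φ : ℝ} {ℓ s q : (M₀ : ℕ) → (Fin M₀ → E3) → Fin M₀ → ℝ}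
    (hE : SlavedEnvelopeAt η₃ τ ℓ s q) (hR : ChartRoom ρ ε η₂ η₃ τ κ κ₁) (hC : EnvelopeCert η₃ κ κ₁ φ ℓ s q) :
    EdgeFarFloor (63 / 10) (63 / 10) ρ ε η₂ φ :=
  edgeFar_of_family ((familyEnvelope_hom_iff η₃ τ ℓ s q).2 hE) ((familyRoom_hom_iff ρ ε η₂ η₃ τ κ κ₁).2 hR)
    ((familyCert_hom_iff η₃ κ κ₁ φ ℓ s q).2 hC)

/-- The three-column modulus is monotone in `t ≥ 0` when `ℓ, q ≥ 0` (so `FamilyCert.anti_law` applies between dominated laws). [folklore] -/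
theorem lsqModulus_mono {ℓ s q : (M₀ : ℕ) → (Fin M₀ → E3) → Fin M₀ → ℝ} {M₀ : ℕ} {z₀ : Fin M₀ → E3} {c₀ : Fin M₀} (hℓ : 0 ≤ ℓ M₀ z₀ c₀)
    (hq : 0 ≤ q M₀ z₀ c₀) {t t' : ℝ} (ht : 0 ≤ t) (hle : t ≤ t') : lsqModulus ℓ s q M₀ z₀ c₀ t ≤ lsqModulus ℓ s q M₀ z₀ c₀ t' := by
  simp only [lsqModulus]
  have h₁ : ℓ M₀ z₀ c₀ * t ≤ ℓ M₀ z₀ c₀ * t' := mul_le_mul_of_nonneg_left hle hℓ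
  have h₂ : t ^ 2 ≤ t' ^ 2 := by nlinarith
  have h₃ : q M₀ z₀ c₀ * t ^ 2 ≤ q M₀ z₀ c₀ * t' ^ 2 := mul_le_mul_of_nonneg_left h₂ hq
  linarith

/-- The exterior column only adds: `lsqModulus ℓ s q ≤ lsqxModulus ℓ s q x` pointwise for `x ≥ 0`, so an (F1) proved WITHOUT the column gives the one with it,
and an (F3) certified WITH the column gives the one without. [formal bookkeeping] -/
theorem lsqModulus_le_lsqx {ℓ s q x : (M₀ : ℕ) → (Fin M₀ → E3) → Fin M₀ → ℝ} (hx : ∀ (M₀ : ℕ) (z₀ : Fin M₀ → E3) (c₀ : Fin M₀), 0 ≤ x M₀ z₀ c₀)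
    (M₀ : ℕ) (z₀ : Fin M₀ → E3) (c₀ : Fin M₀) (t : ℝ) : lsqModulus ℓ s q M₀ z₀ c₀ t ≤ lsqxModulus ℓ s q x M₀ z₀ c₀ t := by
  simp only [lsqModulus, lsqxModulus]
  linarith [hx M₀ z₀ c₀]

/-- Auxiliary step (`familyEnvelope lsqx of lsq`). [formal bookkeeping] -/
theorem familyEnvelope_lsqx_of_lsq {𝓘 : (M₀ : ℕ) → (Fin M₀ → E3) → Fin M₀ → Prop} {τ : ℝ} {ℓ s q x : (M₀ : ℕ) → (Fin M₀ → E3) → Fin M₀ → ℝ}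
    (h : FamilyEnvelope 𝓘 τ (lsqModulus ℓ s q)) (hx : ∀ (M₀ : ℕ) (z₀ : Fin M₀ → E3) (c₀ : Fin M₀), 0 ≤ x M₀ z₀ c₀) :
    FamilyEnvelope 𝓘 τ (lsqxModulus ℓ s q x) :=
  h.mono_modulus fun M₀ z₀ c₀ t _ => lsqModulus_le_lsqx hx M₀ z₀ c₀ t

/-- Auxiliary step (`familyCert lsq of lsqx`). [formal bookkeeping] -/
theorem familyCert_lsq_of_lsqx {𝓘 : (M₀ : ℕ) → (Fin M₀ → E3) → Fin M₀ → Prop} {φ : ℝ} {ℓ s q x : (M₀ : ℕ) → (Fin M₀ → E3) → Fin M₀ → ℝ}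
    {T : (M₀ : ℕ) → (Fin M₀ → E3) → Fin M₀ → ℝ} (h : FamilyCert 𝓘 φ (lsqxModulus ℓ s q x) T)
    (hT : ∀ (M₀ : ℕ) (z₀ : Fin M₀ → E3) (c₀ : Fin M₀), 𝓘 M₀ z₀ c₀ → 0 ≤ T M₀ z₀ c₀)
    (hx : ∀ (M₀ : ℕ) (z₀ : Fin M₀ → E3) (c₀ : Fin M₀), 0 ≤ x M₀ z₀ c₀) : FamilyCert 𝓘 φ (lsqModulus ℓ s q) T :=
  h.anti_modulus hT fun M₀ z₀ c₀ t _ => lsqModulus_le_lsqx hx M₀ z₀ c₀ t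

/-- The linear law is dominated by the root law (`κ½ ≥ 0`), so a cluster charted linearly is charted at the root law and a certificate at the root law certifies
the linear one: the census may certify ONE dominating law whatever the LP decides. [folklore] -/
theorem linearLaw_le_rootLaw {κ κh κ₁ : ℝ} (hκh : 0 ≤ κh) (M₀ : ℕ) (z₀ : Fin M₀ → E3) (c₀ : Fin M₀) :
    linearLaw κ κ₁ M₀ z₀ c₀ ≤ rootLaw κ κh κ₁ M₀ z₀ c₀ := by
  simp only [linearLaw, rootLaw]
  have := mul_nonneg hκh (Real.sqrt_nonneg (windowRoom z₀ c₀))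
  linarith

/-- Auxiliary step (`familyRoom root of linear`). [formal bookkeeping] -/
theorem familyRoom_root_of_linear {𝓘 : (M₀ : ℕ) → (Fin M₀ → E3) → Fin M₀ → Prop} {ρ ε η₂ τ κ κh κ₁ : ℝ} (hκh : 0 ≤ κh)
    (h : FamilyRoom 𝓘 ρ ε η₂ τ (linearLaw κ κ₁)) : FamilyRoom 𝓘 ρ ε η₂ τ (rootLaw κ κh κ₁) :=
  h.mono_law (linearLaw_le_rootLaw hκh)

/-- At ZERO modulus (F3) over the homogeneous family is the landed (H) programme restricted: `HomFloor φ → FamilyCert (homFamily η₃) φ (lsqModulus 0 0 0) T`. [formal bookkeeping] -/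
theorem familyCert_hom_zero_of_homFloor {φ : ℝ} (η₃ : ℝ) (T : (M₀ : ℕ) → (Fin M₀ → E3) → Fin M₀ → ℝ) (h : HomFloor φ) :
    FamilyCert (homFamily η₃) φ (lsqModulus (fun _ _ _ => 0) (fun _ _ _ => 0) (fun _ _ _ => 0)) T := by
  intro M₀ z₀ c₀ hI
  have := h M₀ z₀ c₀ hI.1 hI.2.1
  simp only [lsqModulus, zero_mul, add_zero, sub_zero]
  exact this

/-! ## §4. BENT (two-scale) chart families: the smooth part of the non-affinity goes INTO the chart -/

/-- **`IsBentBall 𝓑 R z₁ c₁`** — the instance `(z₁, c₁)` is the image of a homogeneous `R`-ball instance `(z₀, c₁)` (same index type, same centre index)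
under a BENDING map `b ∈ 𝓑` acting on positions relative to the centre: `z₁ a − z₁ c₁ = b (z₀ a − z₀ c₁)`.  `𝓑` is a parameter (the census's choice: e.g.
`id +` polynomial maps of degree ≤ 3 with small coefficients); `id ∈ 𝓑` makes every homogeneous instance bent. -/
def IsBentBall (𝓑 : Set (E3 → E3)) (R : ℝ) {M : ℕ} (z₁ : Fin M → E3) (c₁ : Fin M) : Prop :=
  ∃ (b : E3 → E3) (z₀ : Fin M → E3), b ∈ 𝓑 ∧ IsHomBall R z₀ c₁ ∧ ∀ a, z₁ a - z₁ c₁ = b (z₀ a - z₀ c₁)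

/-- The BENT chart family: admissible bent instances with an `η₃`-good centre. -/
def bentFamily (𝓑 : Set (E3 → E3)) (η₃ : ℝ) : (M₀ : ℕ) → (Fin M₀ → E3) → Fin M₀ → Prop :=
  fun M₀ z₁ c₁ => Admissible M₀ z₁ c₁ ∧ IsBentBall 𝓑 (133 / 10) z₁ c₁ ∧ GoodAtScale η₃ (3 / 2) z₁ c₁

/-- A homogeneous ball is bent by the identity. [formal bookkeeping] -/
theorem isBentBall_of_isHomBall {𝓑 : Set (E3 → E3)} (hid : id ∈ 𝓑) {R : ℝ} {M : ℕ} {z : Fin M → E3} {c : Fin M} (h : IsHomBall R z c) :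
    IsBentBall 𝓑 R z c :=
  ⟨id, z, hid, h, fun _ => rfl⟩

/-- ★ `homFamily η₃ ≤ bentFamily 𝓑 η₃` whenever `id ∈ 𝓑`. [formal bookkeeping] -/
theorem homFamily_le_bentFamily {𝓑 : Set (E3 → E3)} (hid : id ∈ 𝓑) (η₃ : ℝ) : FamilyLE (homFamily η₃) (bentFamily 𝓑 η₃) :=
  fun _ _ _ h => ⟨h.1, isBentBall_of_isHomBall hid h.2.1, h.2.2⟩

/-- The bent family grows with `𝓑` and with `η₃`. [formal bookkeeping] -/
theorem bentFamily_le {𝓑 𝓑' : Set (E3 → E3)} (hB : 𝓑 ⊆ 𝓑') {η₃ η₃' : ℝ} (hle : η₃ ≤ η₃') : FamilyLE (bentFamily 𝓑 η₃) (bentFamily 𝓑' η₃') := by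
  rintro M₀ z₁ c₁ ⟨hz, ⟨b, z₀, hb, hhom, hab⟩, hg⟩
  exact ⟨hz, ⟨b, z₀, hB hb, hhom, hab⟩, goodAtScale_mono hle hg⟩

/-- ★★ THE TRADE, bent vs homogeneous (`id ∈ 𝓑`): the homogeneous room law GIVES the bent one (F2), the bent envelope and certificate GIVE the homogeneous
ones (F1, F3).  So the bent line is (F1)/(F3)-harder and (F2)-easier — exactly where FLAG-2 says the homogeneous line is in danger. [folklore] -/
theorem familyRoom_bent_of_hom {𝓑 : Set (E3 → E3)} (hid : id ∈ 𝓑) {ρ ε η₂ η₃ τ : ℝ} {T : (M₀ : ℕ) → (Fin M₀ → E3) → Fin M₀ → ℝ}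
    (h : FamilyRoom (homFamily η₃) ρ ε η₂ τ T) : FamilyRoom (bentFamily 𝓑 η₃) ρ ε η₂ τ T :=
  h.mono_family (homFamily_le_bentFamily hid η₃)

/-- Auxiliary step (`familyEnvelope hom of bent`). [formal bookkeeping] -/
theorem familyEnvelope_hom_of_bent {𝓑 : Set (E3 → E3)} (hid : id ∈ 𝓑) {η₃ τ : ℝ} {Φ : (M₀ : ℕ) → (Fin M₀ → E3) → Fin M₀ → ℝ → ℝ}
    (h : FamilyEnvelope (bentFamily 𝓑 η₃) τ Φ) : FamilyEnvelope (homFamily η₃) τ Φ :=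
  h.anti_family (homFamily_le_bentFamily hid η₃)

/-- Auxiliary step (`familyCert hom of bent`). [formal bookkeeping] -/
theorem familyCert_hom_of_bent {𝓑 : Set (E3 → E3)} (hid : id ∈ 𝓑) {η₃ φ : ℝ} {Φ : (M₀ : ℕ) → (Fin M₀ → E3) → Fin M₀ → ℝ → ℝ}
    {T : (M₀ : ℕ) → (Fin M₀ → E3) → Fin M₀ → ℝ} (h : FamilyCert (bentFamily 𝓑 η₃) φ Φ T) : FamilyCert (homFamily η₃) φ Φ T :=
  h.anti_family (homFamily_le_bentFamily hid η₃)

/-- ★★ THE BENT LINE decides the edge band: (F1) ∧ (F2) ∧ (F3) over `bentFamily 𝓑 η₃` ⟹ `EdgeFarFloor (63/10) (63/10) ρ ε η₂ φ` (an instance of the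
parametric seam, displayed for the record; any `𝓑`, modulus, law). [folklore] -/
theorem edgeFar_of_bent {𝓑 : Set (E3 → E3)} {ρ ε η₂ η₃ τ φ : ℝ} {Φ : (M₀ : ℕ) → (Fin M₀ → E3) → Fin M₀ → ℝ → ℝ}
    {T : (M₀ : ℕ) → (Fin M₀ → E3) → Fin M₀ → ℝ} (hE : FamilyEnvelope (bentFamily 𝓑 η₃) τ Φ) (hR : FamilyRoom (bentFamily 𝓑 η₃) ρ ε η₂ τ T)
    (hC : FamilyCert (bentFamily 𝓑 η₃) φ Φ T) : EdgeFarFloor (63 / 10) (63 / 10) ρ ε η₂ φ :=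
  edgeFar_of_family hE hR hC

/-- ★ THE MIXED LINE (the intended use): chart room proved for HOMOGENEOUS charts at some law `T` (if the census LP bounds it after all) OR only for bent charts;
envelope and certificate done over the BENT family; either way the edge band follows.  Here: homogeneous room + bent envelope/certificate. [folklore] -/
theorem edgeFar_of_bentEnvelope_of_homRoom_of_bentCert {𝓑 : Set (E3 → E3)} (hid : id ∈ 𝓑) {ρ ε η₂ η₃ τ φ : ℝ}
    {Φ : (M₀ : ℕ) → (Fin M₀ → E3) → Fin M₀ → ℝ → ℝ} {T : (M₀ : ℕ) → (Fin M₀ → E3) → Fin M₀ → ℝ}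
    (hE : FamilyEnvelope (bentFamily 𝓑 η₃) τ Φ) (hR : FamilyRoom (homFamily η₃) ρ ε η₂ τ T) (hC : FamilyCert (bentFamily 𝓑 η₃) φ Φ T) :
    EdgeFarFloor (63 / 10) (63 / 10) ρ ε η₂ φ :=
  edgeFar_of_family hE (familyRoom_bent_of_hom hid hR) hC

/-! ## §5. The record: `ρ = 24/5`, `ε = 1/100`, any floor `φ₁ ≥ 0`, the [SOFT-FAR] residual of record at `η₂` -/

/-- ★★ RECORD NODE of this generation (parametric; Lean fixes no census number):
`FamilyEnvelope 𝓘 τ Φ → FamilyRoom 𝓘 (24/5) (1/100) η₂ τ T → FamilyCert 𝓘 φ₁ Φ T → SoftFarFloor (63/10) (63/10) (24/5) (1/100) η₂ φ₁ →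
CoreOffTubeFloor (63/10) (63/10) (24/5) (1/100) φ₁`. -/
theorem coreOff_record_of_family_of_soft {𝓘 : (M₀ : ℕ) → (Fin M₀ → E3) → Fin M₀ → Prop} {η₂ τ φ₁ : ℝ}
    {Φ : (M₀ : ℕ) → (Fin M₀ → E3) → Fin M₀ → ℝ → ℝ} {T : (M₀ : ℕ) → (Fin M₀ → E3) → Fin M₀ → ℝ}
    (hE : FamilyEnvelope 𝓘 τ Φ) (hR : FamilyRoom 𝓘 (24 / 5) (1 / 100) η₂ τ T) (hC : FamilyCert 𝓘 φ₁ Φ T)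
    (hS : SoftFarFloor (63 / 10) (63 / 10) (24 / 5) (1 / 100) η₂ φ₁) : CoreOffTubeFloor (63 / 10) (63 / 10) (24 / 5) (1 / 100) φ₁ :=
  coreOff_of_family_of_soft hE hR hC hS

/-- ★★ … threaded through the tree's record assembly (m = 1/625, μ_T = 1/1000, A = 3/5000; ANY residual floor `φ₁ ≥ 0`):
`HomFloor (1/625) → TailPenalty (24/5) (1/1000) → CoreCoreRelief … (3/5000) → (F1) → (F2) → (F3)(φ₁) → SoftFarFloor … η₂ φ₁ → 0 ≤ φ₁ → AnnularPhaseFloor … (1/1000) →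
PolyTextureFloor … (1/1000) → AnnularDefectFloor (24/5) (63/10) → DefectiveCollarFloor (24/5) → StrainedPatchRec`. -/
theorem strainedPatchRec_of_homFloor_625_of_family_of_soft {𝓘 : (M₀ : ℕ) → (Fin M₀ → E3) → Fin M₀ → Prop} {η₂ τ φ₁ : ℝ}
    {Φ : (M₀ : ℕ) → (Fin M₀ → E3) → Fin M₀ → ℝ → ℝ} {T : (M₀ : ℕ) → (Fin M₀ → E3) → Fin M₀ → ℝ}
    (hH : HomFloor (1 / 625)) (hT : TailPenalty (24 / 5) (1 / 1000)) (hRl : CoreCoreRelief (63 / 10) (63 / 10) (24 / 5) (1 / 100) (3 / 5000))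
    (hE : FamilyEnvelope 𝓘 τ Φ) (hR : FamilyRoom 𝓘 (24 / 5) (1 / 100) η₂ τ T) (hC : FamilyCert 𝓘 φ₁ Φ T)
    (hS : SoftFarFloor (63 / 10) (63 / 10) (24 / 5) (1 / 100) η₂ φ₁) (h₁ : 0 ≤ φ₁) (hF : AnnularPhaseFloor (63 / 10) (24 / 5) (63 / 10) (1 / 1000))
    (hP : PolyTextureFloor (63 / 10) (24 / 5) (1 / 1000)) (hA : AnnularDefectFloor (24 / 5) (63 / 10)) (hD : DefectiveCollarFloor (24 / 5)) :
    StrainedPatchRec :=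
  strainedPatchRec_of_homFloor_of_tailPenalty_of_coreRelief_of_coreOff_of_annularPhase_of_poly_of_annular_of_near (by norm_num) hH hT hRl
    seam_arith_core (coreOff_record_of_family_of_soft hE hR hC hS) hF hP h₁ (by norm_num) (by norm_num) hA hD

/-- ★ The record through the BENT line with the homogeneous room law kept where the LP may still deliver it (`id ∈ 𝓑`; residual of record `η₂ = 1/10`, `φ₁ = 0`):
`FamilyEnvelope (bentFamily 𝓑 η₃) τ Φ → FamilyRoom (homFamily η₃) (24/5) (1/100) (1/10) τ T → FamilyCert (bentFamily 𝓑 η₃) 0 Φ T →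
SoftFarFloor (63/10) (63/10) (24/5) (1/100) (1/10) 0 → CoreOffTubeFloor (63/10) (63/10) (24/5) (1/100) 0`. -/
theorem coreOff_record_zero_of_bent_of_homRoom_of_soft_tenth {𝓑 : Set (E3 → E3)} (hid : id ∈ 𝓑) {η₃ τ : ℝ}
    {Φ : (M₀ : ℕ) → (Fin M₀ → E3) → Fin M₀ → ℝ → ℝ} {T : (M₀ : ℕ) → (Fin M₀ → E3) → Fin M₀ → ℝ}
    (hE : FamilyEnvelope (bentFamily 𝓑 η₃) τ Φ) (hR : FamilyRoom (homFamily η₃) (24 / 5) (1 / 100) (1 / 10) τ T)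
    (hC : FamilyCert (bentFamily 𝓑 η₃) 0 Φ T) (hS : SoftFarFloor (63 / 10) (63 / 10) (24 / 5) (1 / 100) (1 / 10) 0) :
    CoreOffTubeFloor (63 / 10) (63 / 10) (24 / 5) (1 / 100) 0 :=
  coreOff_of_family_of_soft hE (familyRoom_bent_of_hom hid hR) hC hS

/-- ★ g50's record line recovered from (E1-At) (FLAG-1 discharged at the record): `SlavedEnvelopeAt η₃ τ ℓ s q → ChartRoom (24/5) (1/100) η₂ η₃ τ κ κ₁ →
EnvelopeCert η₃ κ κ₁ φ₁ ℓ s q → SoftFarFloor … η₂ φ₁ → CoreOffTubeFloor (63/10) (63/10) (24/5) (1/100) φ₁`. -/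
theorem coreOff_record_of_envelopeAt_of_room_of_cert_of_soft {η₂ η₃ τ κ κ₁ φ₁ : ℝ} {ℓ s q : (M₀ : ℕ) → (Fin M₀ → E3) → Fin M₀ → ℝ}
    (hE : SlavedEnvelopeAt η₃ τ ℓ s q) (hR : ChartRoom (24 / 5) (1 / 100) η₂ η₃ τ κ κ₁) (hC : EnvelopeCert η₃ κ κ₁ φ₁ ℓ s q)
    (hS : SoftFarFloor (63 / 10) (63 / 10) (24 / 5) (1 / 100) η₂ φ₁) : CoreOffTubeFloor (63 / 10) (63 / 10) (24 / 5) (1 / 100) φ₁ :=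
  coreOff_of_envelopeAt_of_room_of_cert_of_soft hE hR hC hS

end Summit.AtomisticToContinuum.Crystallization.Theorems.FrustratedLawDichotomyStrainedPatchChartFamiliesBent
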